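import Mathlib

/-!
# Route `FilamentSkeletonRss` · crux `SkeletonJ1G` (stmt-27849) · child `TangentSkeletonNearStraight` (stmt-28295) ·
# line `child_tangent_analytic_strip` — VOCABULARY for stub P3 `stub_liaSymbol : LiaSymbolBound`

Lane ns-filament-19175-p1 g12 (prover), 2026-08-28.  The registered child skeleton
`Cruxes/SkeletonJ1G/Lines/child_tangent_analytic_strip.lean` (planner-cstrat-…-27849-s1-g2, sha16 3ad1a13e3bb9c4f5,
registered on stmt-NavierStokesRegularity-28295) posits the EXACT STATIC SELF-INDUCTION SYMBOL of the crux's algebraic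
(Rosenhead–Moore) kernel and three inequalities about it (`LiaSymbolBound`, stub P3, "the cheap decisive stub; pure real
analysis").  A line file is not importable from `Theorems/`, so the two definitions are re-declared here LETTER FOR LETTER
(same binder names, same bodies) for the helper files that prove the stub; the closing theorem will be
`theorem stub_liaSymbol : LiaSymbolBound` over THIS copy, definitionally the line's statement.

HONEST FRAMING: vocabulary for a lemma about one explicit real integral; it serves a HYPOTHETICAL filament-skeleton line on
the NEGATIVE side of a MODEL route.  Nothing here bears on Navier–Stokes regularity or blow-up; `SkeletonJ1G`,
`TangentSkeletonNearStraight` stay OPEN.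
-/

set_option linter.dupNamespace false

noncomputable section

namespace Summit.NavierStokesRegularity.NavierStokesRegularity.Theorems.AnalyticStripLiaSymbol

/-- THE EXACT STATIC SELF-INDUCTION SYMBOL of the crux's algebraic (Rosenhead–Moore) kernel, core scale normalised to `1`:
`𝔖(x) = ∫₀^∞ (1 − cos(xh) − xh·sin(xh))·(1+h²)^{-3/2} dh` (`= 1 − x·K₁(x) − x²·K₀(x)` in modified Bessel functions;
Mathlib has no `K_ν`, so the integral is the definition).  The linearised normal self-induced velocity of a straight
matched-core filament displaced by `ξ̂ e^{ikτ}` is `(Γγ/4π)·(2/μ²)·𝔖(kμ)·t × ξ̂ e^{ikτ}`; local induction replaces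
`𝔖(kμ)` by `−(kμ)²·L̃/2`.  VERBATIM copy of `Cruxes.TangentSkeletonNearStraight.AnalyticStrip.liaSym`
(route-posited object of line `child_tangent_analytic_strip`; not a Literature definition). -/
def liaSym (x : ℝ) : ℝ :=
  ∫ h in Set.Ioi (0:ℝ), (1 - Real.cos (x * h) - x * h * Real.sin (x * h)) * ((1 + h ^ 2) ^ (3 / 2 : ℝ))⁻¹

/-- STUB P3 statement · THE LOCAL-INDUCTION MULTIPLIER BOUND (pure real analysis).
(a) the exact symbol never exceeds `x²/12` (numerically `sup 𝔖/x² = 0.0686` at `x ≈ 2.34`); (b) `𝔖 ≥ −x²/3` beyond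
`x = ½` (numerically `min 𝔖 = −0.0616` at `x ≈ 0.6`); (c) the local-induction asymptotics with the Klein–Majda constant,
`𝔖(x) = x²·((log(x/2)+γ_E)/2 + 1/4) + O(x⁴ log x)` on `(0, ½]` (numerically the remainder is `≤ 0.196·x⁴(|log x|+1)`).
VERBATIM copy of `Cruxes.TangentSkeletonNearStraight.AnalyticStrip.LiaSymbolBound` over this file's `liaSym`
(route-posited stub statement; not a Literature fact). -/
def LiaSymbolBound : Prop :=
  (∀ x : ℝ, 0 < x → liaSym x ≤ x ^ 2 / 12) ∧
  (∀ x : ℝ, 1 / 2 ≤ x → -(x ^ 2 / 3) ≤ liaSym x) ∧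
  (∀ x : ℝ, 0 < x → x ≤ 1 / 2 →
    |liaSym x - x ^ 2 * ((Real.log (x / 2) + Real.eulerMascheroniConstant) / 2 + 1 / 4)| ≤ x ^ 4 * (|Real.log x| + 1))

/-- The symbol is EVEN: `𝔖(−x) = 𝔖(x)` (the integrand is even in `x`). -/
theorem liaSym_neg (x : ℝ) : liaSym (-x) = liaSym x := by
  unfold liaSym
  refine MeasureTheory.setIntegral_congr_fun measurableSet_Ioi fun h _ => ?_
  simp only [neg_mul, Real.cos_neg, Real.sin_neg, mul_neg, neg_neg]

/-- The symbol vanishes at `x = 0` (the integrand is identically `0`). -/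
theorem liaSym_zero : liaSym 0 = 0 := by
  unfold liaSym
  simp

end Summit.NavierStokesRegularity.NavierStokesRegularity.Theorems.AnalyticStripLiaSymbol
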